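import Literature.Probability.RandomPlanarGeometry.HexSAWStripWidthTwoComplete
import Literature.Probability.RandomPlanarGeometry.HexSAWStripSurfaceWidthOne
import HarnessLib

/-!
# The second strip threshold is exact: `y_2 = (10 + 8√2)/7`, strictly below `y_1 = 2 + √2`

Topic `Literature/Probability/RandomPlanarGeometry` (continues `HexSAWStripWidthTwo.lean` / `HexSAWStripWidthTwoComplete.lean` —
the solved width-two Duminil-Copin–Smirnov strip: every `β`-walk of `S_{2,L}` is an excursion–weave–excursion walk `W2.fw q`,
`q ∈ W2.paramsB (L+2)` (`W2.exists_param_of_mem`), the family walks are distinct `β`-walks of `S_{2,2N}` (`W2.fw_injOn_paramsB`,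
`W2.fw_mem_beta`) — and the capstone `HexSAWSurfaceFugacity.lean`: `HV.stripYT T = y_T`, the threshold below which
`L ↦ B_{T,L}(x_c; y)` stays bounded; `HexSAWStripSurfaceWidthOne.lean`: `HV.stripYT_one : y_1 = 2 + √2`).
Source frame: N. R. Beaton, M. Bousquet-Mélou, J. de Gier, H. Duminil-Copin, A. J. Guttmann, *The critical fugacity for surface
adsorption of self-avoiding walks on the honeycomb lattice is `1 + √2`*, Comm. Math. Phys. 326 (2014), arXiv:1109.0358v5, §3.2
Corollary 8 (p. 12: "y_T … decreases to the critical fugacity y_c"; proof p. 13: "y_{T+1} < y_T"); the `y = 1` rational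
series of this strip is printed as `B_1(z)` (their width ONE = the lane's `T = 2`; BGJ index = `T − 1`) in N. R. Beaton,
A. J. Guttmann, I. Jensen, J. Phys. A 45 (2012) 035201 (arXiv:1110.1141), §2, together with "the dominant pole being at
`z = z_c(T) > z_c(T+1) > z_c`"; no value of any `y_T` is printed there or in BBdGDCG14 / Beaton 2014 (label lit-1 g14:
`stripYT_two` NEW-IN-WRITING, size S; `yStar_lt_stripYT_two`, `stripYT_two_lt_stripYT_one` CONSOLIDATION instances of the
printed "y_T > y_c", "y_{T+1} < y_T", v5 p. 13).

## What is proved (lane «pcv-sawmu», a-p2 g9; namespace `…SAW.HV`, helper namespace `…SAW.HV.W2`)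

The surface contacts of a width-two walk are its visits to the EVEN positions of the TOP rail (level `3`).  Reading them off the
parameters (`W2.qcon`: a left excursion of depth `2k+1` has `k+1`, a weave block has one iff it ends on the top rail, a right
excursion returning on the top rail has `k'+1`), the `y`-weighted family sum factorises through the weave transfer matrix
`M(y) = [[x², x³y],[x³, x²y]]` (rows = from-rail `⊥, ⊤`).  At `x = x_c` its Perron root reaches `1` exactly when
`det(I − M) = 1 − x_c² − y·x_c²(1 − x_c² + x_c⁴) = 0`, i.e. at
`y_2 := (1 − x_c²)/(x_c²(1 − x_c² + x_c⁴)) = (10 + 8√2)/7 = 3.0448…` (`W2.yTwo`, `W2.yTwo_eq`); the excursion series converge up to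
`x_c⁻⁴ = (2+√2)² > y_2`.  Below `y_2` a Collatz–Wielandt vector bounds all partial sums (`W2.fsumY_le`), so `B_{2,L}(x_c;y)` is
bounded (completeness); at `y_2` the eigenvector `u = (x_c³ y_2, 1 − x_c²)` of `M(y_2)` makes the weave sums grow linearly
(`W2.fsumY_yTwo_ge`), so `B_{2,2N}(x_c; y_2) → ∞`.  Hence

* **`stripYT_two : stripYT 2 = (10 + 8 * Real.sqrt 2) / 7`**;
* **`stripYT_two_lt_stripYT_one : stripYT 2 < stripYT 1`** and `yStar_lt_stripYT_two : yStar < stripYT 2` — the first STRICT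
  instances `y* < y_2 < y_1` of Corollary 8's printed "y_{T+1} < y_T", "y_T > y_c" in the tree.

Status in print: not stated (the printed y_T's are defined through `ρ_T(y_T) = x_c` and only estimated numerically for larger
T in the adsorption literature); lane corollary of the solved width-two strip — new in writing, size S.
-/

noncomputable section

open Finset Filter Topology

namespace Literature.Probability.RandomPlanarGeometry.SAW.HV

namespace W2

/-! ### §1. Surface contacts of the family walks: visits to the even positions of the top rail -/

/-- An abstract ladder vertex is a surface contact of `S_2` (level `3`) iff it lies on the top rail at an even position.
[cite: DuminilCopinSmirnov2012, §3 (Fig. 3: S_{T,L}); BeatonBousquetMelouDeGierDuminilCopinGuttmann2014, §2 (arXiv v5 p. 4: c(γ))] -/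
def topEven (a : Bool × ℤ) : Bool := a.1 && decide (a.2 % 2 = 0)

/-- `lev (ladV a) = 3 ↔ topEven a`. [cite: DuminilCopinSmirnov2012, §3 (Fig. 3)] -/
theorem lev_ladV_eq_three_iff (a : Bool × ℤ) : lev (ladV a) = 3 ↔ topEven a = true := by
  obtain ⟨r, p⟩ := a
  rcases Int.emod_two_eq_zero_or_one p with h | h
  all_goals cases r
  all_goals simp [ladV, lad, topEven, bit, h]

/-- The mirror `p ↦ s·p` (`s = ±1`) preserves `topEven`. [cite: DuminilCopinSmirnov2012, §3 (Fig. 3: the symmetry of S_{T,L})] -/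
theorem topEven_smap {s : ℤ} (hs : s = 1 ∨ s = -1) (a : Bool × ℤ) : topEven (smap s a) = topEven a := by
  obtain ⟨r, p⟩ := a
  rcases hs with rfl | rfl <;> simp [smap, topEven, Int.neg_emod_two]

/-- Surface contacts of an abstract ladder walk = the `topEven` entries of its vertex list.
[cite: BeatonBousquetMelouDeGierDuminilCopinGuttmann2014, §2 (arXiv v5 p. 4: c(γ))] -/
theorem surfContacts_walkOfA (A : List (Bool × ℤ)) (f : Bool) (e : ℤ) :
    surfContacts 2 (walkOfA A f e) = A.countP topEven := by
  rw [walkOfA, surfContacts_cons_append, ← List.countP_eq_length_filter, List.countP_map]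
  refine List.countP_congr fun a _ => ?_
  simp only [Function.comp_apply, decide_eq_true_eq]
  push_cast
  exact lev_ladV_eq_three_iff a

/-- Counting the odd (resp. even) naturals below `n` against a shifted parity test. [folklore] -/
private theorem countP_range_parity (n : ℕ) (c : ℤ) :
    (List.range n).countP (fun i : ℕ => decide (((i : ℤ) + c) % 2 = 0)) =
      if c % 2 = 0 then (n + 1) / 2 else n / 2 := by
  induction n with
  | zero => simp
  | succ n ih =>
    rw [List.range_succ, List.countP_append, ih]
    simp only [List.countP_cons, List.countP_nil, decide_eq_true_eq, zero_add]
    rcases Int.emod_two_eq_zero_or_one c with hc | hc <;> simp only [hc] <;> split_ifs with h <;> omega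

/-- A left excursion of depth `2k+1` has `k+1` surface contacts (the even top positions `−2k, …, 0`).
[cite: DuminilCopinSmirnov2012, §3 (Fig. 3)] -/
theorem countP_topEven_excL (k : ℕ) : (excL k).countP topEven = k + 1 := by
  rw [excL, List.countP_append, List.countP_map, List.countP_map]
  have h1 : (List.range (2 * k + 1)).countP (topEven ∘ fun i : ℕ => (false, -((i : ℤ) + 1))) = 0 := by
    rw [List.countP_eq_zero]; intro i _; simp [topEven]
  have h2 : (List.range (2 * k + 2)).countP (topEven ∘ fun i : ℕ => (true, (i : ℤ) - (2 * k + 1))) =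
      (List.range (2 * k + 2)).countP (fun i : ℕ => decide (((i : ℤ) + (-(2 * k + 1))) % 2 = 0)) :=
    List.countP_congr fun i _ => by simp [topEven, sub_eq_add_neg]
  rw [h1, h2, countP_range_parity]
  have : (-(2 * (k : ℤ) + 1)) % 2 = 1 := by omega
  rw [if_neg (by omega)]
  omega

/-- A weave block over `p+1, p+2` (`p` even) has one surface contact iff it ends on the top rail.
[cite: DuminilCopinSmirnov2012, §3 (Fig. 3)] -/
theorem countP_topEven_block {p : ℤ} (hp : p % 2 = 0) (r b : Bool) :
    (block r b p).countP topEven = if b then 1 else 0 := by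
  unfold block
  have h1 : (p + 1) % 2 = 1 := by omega
  have h2 : (p + 2) % 2 = 0 := by omega
  cases r
  all_goals cases b
  all_goals simp [topEven, h1, h2]

/-- The weave along `l` from an even position has `#{i : lᵢ = ⊤}` surface contacts. [cite: DuminilCopinSmirnov2012, §3 (Fig. 3)] -/
theorem countP_topEven_weave {p : ℤ} (hp : p % 2 = 0) (r : Bool) (l : List Bool) :
    (weave r p l).countP topEven = l.count true := by
  induction l generalizing r p with
  | nil => simp [weave]
  | cons b l ih =>
    rw [weave, List.countP_append, countP_topEven_block hp, ih (by omega), List.count_cons]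
    cases b
    all_goals simp
    all_goals omega

/-- A right excursion of depth `2k+1` from an even position: `k` contacts if it goes out on the top rail, `k+1` if it returns
on it. [cite: DuminilCopinSmirnov2012, §3 (Fig. 3)] -/
theorem countP_topEven_excR {e : ℤ} (he : e % 2 = 0) (c : Bool) (k : ℕ) :
    (excR c e k).countP topEven = if c then k else k + 1 := by
  rw [excR, List.countP_append, List.countP_map, List.countP_map]
  cases c
  · have h1 : (List.range (2 * k + 1)).countP (topEven ∘ fun i : ℕ => (false, e + 1 + (i : ℤ))) = 0 := by
      rw [List.countP_eq_zero]; intro i _; simp [topEven]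
    have h2 : (List.range (2 * k + 2)).countP (topEven ∘ fun i : ℕ => (!false, e + (2 * k + 1) - (i : ℤ))) =
        (List.range (2 * k + 2)).countP (fun i : ℕ => decide (((i : ℤ) + (e + 1)) % 2 = 0)) :=
      List.countP_congr fun i _ => by
        simp only [Function.comp_apply, topEven, Bool.not_false, Bool.true_and, decide_eq_true_eq]
        constructor
        · intro h; omega
        · intro h; omega
    rw [h1, h2, countP_range_parity, if_neg (by omega)]
    simp only [zero_add, Bool.false_eq_true, if_false]
    omega
  · have h1 : (List.range (2 * k + 1)).countP (topEven ∘ fun i : ℕ => (true, e + 1 + (i : ℤ))) =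
        (List.range (2 * k + 1)).countP (fun i : ℕ => decide (((i : ℤ) + (e + 1)) % 2 = 0)) :=
      List.countP_congr fun i _ => by
        simp only [Function.comp_apply, topEven, Bool.true_and, decide_eq_true_eq]
        constructor
        · intro h; omega
        · intro h; omega
    have h2 : (List.range (2 * k + 2)).countP (topEven ∘ fun i : ℕ => (!true, e + (2 * k + 1) - (i : ℤ))) = 0 := by
      rw [List.countP_eq_zero]; intro i _; simp [topEven]
    rw [h1, h2, countP_range_parity, if_neg (by omega)]
    simp only [add_zero, if_true]
    omega

/-- The prefix (origin + optional left excursion) has `0` or `k+1` contacts. [cite: DuminilCopinSmirnov2012, §3 (Fig. 3)] -/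
theorem countP_topEven_pre (left : Option ℕ) : (pre left).countP topEven = left.elim 0 fun k => k + 1 := by
  cases left with
  | none => simp [pre, topEven]
  | some k => rw [pre]; simp [topEven, countP_topEven_excL]

/-- **The surface contacts of a parameter**: `k+1` for a left excursion of depth `2k+1`, one per weave block ending on the top
rail, and `k'` resp. `k'+1` for a right excursion leaving on the top resp. bottom rail.
[cite: BeatonBousquetMelouDeGierDuminilCopinGuttmann2014, §2 (arXiv v5 p. 4: c(γ)); lane: width-two bookkeeping] -/
def qcon (q : Param) : ℕ :=
  q.2.1.elim 0 (fun k => k + 1) + q.2.2.1.count true +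
    q.2.2.2.elim 0 (fun k => if wend q.2.1.isSome q.2.2.1 then k else k + 1)

/-- Contacts of the encoded list. [cite: DuminilCopinSmirnov2012, §3 (Fig. 3)] -/
theorem countP_topEven_encode (left : Option ℕ) (l : List Bool) (right : Option ℕ) :
    (encode left l right).countP topEven =
      left.elim 0 (fun k => k + 1) + l.count true + right.elim 0 (fun k => if wend left.isSome l then k else k + 1) := by
  rw [encode, List.countP_append, List.countP_append, countP_topEven_pre, countP_topEven_weave (by decide)]
  cases right with
  | none => simp
  | some k =>
    simp only [Option.elim_some]
    rw [countP_topEven_excR (by omega)]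

/-- **`c(fw q) = qcon q`** for `s = ±1`. [cite: BeatonBousquetMelouDeGierDuminilCopinGuttmann2014, §2 (arXiv v5 p. 4: c(γ)); lane: width-two bookkeeping] -/
theorem surfContacts_fw {q : Param} (hs : q.1 = 1 ∨ q.1 = -1) : surfContacts 2 (fw q) = qcon q := by
  obtain ⟨s, left, l, right⟩ := q
  rw [fw, famWalk, surfContacts_walkOfA, List.countP_map]
  rw [List.countP_congr (fun a _ => by rw [Function.comp_apply, topEven_smap hs]), countP_topEven_encode]
  rfl

/-! ### §2. The `y`-weighted weave transfer sums and the matrix `M(y) = [[x², x³y],[x³, x²y]]` -/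

/-- Words in `bwords n` have length `n`. [folklore] -/
private theorem length_of_mem_bwords' {n : ℕ} {l : List Bool} (h : l ∈ bwords n) : l.length = n := by
  induction n generalizing l with
  | zero => simp [bwords] at h; subst h; rfl
  | succ n ih =>
    simp only [bwords, Finset.mem_union, Finset.mem_map, Function.Embedding.coeFn_mk] at h
    rcases h with ⟨l', hl', rfl⟩ | ⟨l', hl', rfl⟩ <;> simp [ih hl']

/-- Summing over words of length `n+1` by the first letter. [folklore] -/
private theorem sum_bwords_succ' (n : ℕ) (f : List Bool → ℝ) :
    ∑ l ∈ bwords (n + 1), f l = ∑ l ∈ bwords n, (f (false :: l) + f (true :: l)) := by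
  rw [bwords, Finset.sum_union, Finset.sum_map, Finset.sum_map, ← Finset.sum_add_distrib]
  · rfl
  · rw [Finset.disjoint_left]
    rintro l h1 h2
    simp only [Finset.mem_map, Function.Embedding.coeFn_mk] at h1 h2
    obtain ⟨l1, -, rfl⟩ := h1
    obtain ⟨l2, -, h⟩ := h2
    simp at h

/-- **The `y`-weighted weave transfer sum** over words of length `n` from rail `r`, end weight `g`:
`Σ_l x^{wlen r l} y^{#⊤(l)} g(wend r l)`. [cite: BeatonBousquetMelouDeGierDuminilCopinGuttmann2014, §2, eq. (10) (arXiv v5 p. 6: B_{T,L}(x;y)); lane: width-two transfer bookkeeping] -/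
def wsumY (x y : ℝ) (g : Bool → ℝ) (n : ℕ) (r : Bool) : ℝ :=
  ∑ l ∈ bwords n, x ^ wlen r l * y ^ l.count true * g (wend r l)

/-- `wsumY` at length `0`. [cite: BeatonBousquetMelouDeGierDuminilCopinGuttmann2014, §2, eq. (10) (arXiv v5 p. 6: B_{T,L}(x;y)); lane: width-two transfer bookkeeping] -/
theorem wsumY_zero (x y : ℝ) (g : Bool → ℝ) (r : Bool) : wsumY x y g 0 r = g r := by
  simp [wsumY, bwords, wlen, wend]

/-- **The transfer step**: `W_{n+1}(r) = x^{2|3} W_n(⊥) + x^{3|2}·y·W_n(⊤)` — the matrix `M(y) = [[x², x³y],[x³, x²y]]`.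
[cite: BeatonBousquetMelouDeGierDuminilCopinGuttmann2014, §2, eq. (10) (arXiv v5 p. 6); lane: width-two transfer bookkeeping] -/
theorem wsumY_succ (x y : ℝ) (g : Bool → ℝ) (n : ℕ) (r : Bool) :
    wsumY x y g (n + 1) r = x ^ (if false = r then 2 else 3) * wsumY x y g n false +
      x ^ (if true = r then 2 else 3) * y * wsumY x y g n true := by
  rw [wsumY, sum_bwords_succ', wsumY, wsumY, Finset.mul_sum, Finset.mul_sum, ← Finset.sum_add_distrib]
  refine Finset.sum_congr rfl fun l _ => ?_
  simp only [wlen, wend, pow_add, List.count_cons_self, List.count_cons_of_ne Bool.false_ne_true, pow_succ]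
  ring

/-- `wsumY ≥ 0` for nonnegative data. [cite: BeatonBousquetMelouDeGierDuminilCopinGuttmann2014, §2, eq. (10) (arXiv v5 p. 6: B_{T,L}(x;y)); lane: width-two transfer bookkeeping] -/
theorem wsumY_nonneg {x y : ℝ} (hx : 0 ≤ x) (hy : 0 ≤ y) {g : Bool → ℝ} (hg : ∀ r, 0 ≤ g r) (n : ℕ) (r : Bool) :
    0 ≤ wsumY x y g n r :=
  Finset.sum_nonneg fun _ _ => mul_nonneg (mul_nonneg (pow_nonneg hx _) (pow_nonneg hy _)) (hg _)

/-- `wsumY` is monotone in the end weight. [cite: BeatonBousquetMelouDeGierDuminilCopinGuttmann2014, §2, eq. (10) (arXiv v5 p. 6: B_{T,L}(x;y)); lane: width-two transfer bookkeeping] -/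
theorem wsumY_mono {x y : ℝ} (hx : 0 ≤ x) (hy : 0 ≤ y) {g g' : Bool → ℝ} (hgg' : ∀ r, g r ≤ g' r) (n : ℕ) (r : Bool) :
    wsumY x y g n r ≤ wsumY x y g' n r :=
  Finset.sum_le_sum fun _ _ => mul_le_mul_of_nonneg_left (hgg' _) (mul_nonneg (pow_nonneg hx _) (pow_nonneg hy _))

/-- `det(I − M(y)) = (1 − x²)(1 − x²y) − x⁶y`. [cite: BeatonGuttmannJensen2012, §2 (B_1(z), their width 1 = lane T = 2: the denominator factor 1 − 2z² + z⁴ − z⁶ = det(I − M(1))); lane: the y-weighted determinant] -/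
def wdet (x y : ℝ) : ℝ := (1 - x ^ 2) * (1 - x ^ 2 * y) - x ^ 6 * y

/-- The resolvent `(I − M)⁻¹ g`, bottom component. [cite: BeatonGuttmannJensen2012, §2 (B_1(z), their width 1 = lane T = 2); lane: explicit resolvent of the 2 × 2 transfer matrix] -/
def Rbot (x y : ℝ) (g : Bool → ℝ) : ℝ := ((1 - x ^ 2 * y) * g false + x ^ 3 * y * g true) / wdet x y

/-- The resolvent `(I − M)⁻¹ g`, top component. [cite: BeatonGuttmannJensen2012, §2 (B_1(z), their width 1 = lane T = 2); lane: explicit resolvent of the 2 × 2 transfer matrix] -/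
def Rtop (x y : ℝ) (g : Bool → ℝ) : ℝ := (x ^ 3 * g false + (1 - x ^ 2) * g true) / wdet x y

/-- `R = I + M R`, bottom row. [cite: BeatonBousquetMelouDeGierDuminilCopinGuttmann2014, §2, eq. (10) (arXiv v5 p. 6: B_{T,L}(x;y)); lane: width-two transfer bookkeeping] -/
theorem Rbot_eq {x y : ℝ} (g : Bool → ℝ) (hdet : wdet x y ≠ 0) :
    g false + x ^ 2 * Rbot x y g + x ^ 3 * y * Rtop x y g = Rbot x y g := by
  unfold Rbot Rtop
  field_simp
  unfold wdet
  ring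

/-- `R = I + M R`, top row. [cite: BeatonBousquetMelouDeGierDuminilCopinGuttmann2014, §2, eq. (10) (arXiv v5 p. 6: B_{T,L}(x;y)); lane: width-two transfer bookkeeping] -/
theorem Rtop_eq {x y : ℝ} (g : Bool → ℝ) (hdet : wdet x y ≠ 0) :
    g true + x ^ 3 * Rbot x y g + x ^ 2 * y * Rtop x y g = Rtop x y g := by
  unfold Rbot Rtop
  field_simp
  unfold wdet
  ring

/-- **Collatz–Wielandt bound**: when `det(I − M(y)) > 0` (and `x²y ≤ 1`, `x² ≤ 1`), ALL partial sums `Σ_{n<N} W_n` are bounded by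
the resolvent `(I − M)⁻¹ g` — the weave series converges. [cite: BeatonBousquetMelouDeGierDuminilCopinGuttmann2014, Corollary 8 (arXiv v5 p. 12: y_T as the radius of B_T(x_c;y)); lane: width-two transfer bound] -/
theorem sum_wsumY_le {x y : ℝ} (hx : 0 ≤ x) (hy : 0 ≤ y) {g : Bool → ℝ} (hg : ∀ r, 0 ≤ g r) (hdet : 0 < wdet x y)
    (h1 : x ^ 2 * y ≤ 1) (h2 : x ^ 2 ≤ 1) (N : ℕ) :
    (∑ n ∈ Finset.range N, wsumY x y g n false) ≤ Rbot x y g ∧ (∑ n ∈ Finset.range N, wsumY x y g n true) ≤ Rtop x y g := by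
  induction N with
  | zero =>
    simp only [Finset.range_zero, Finset.sum_empty]
    exact ⟨div_nonneg (by nlinarith [hg false, hg true, mul_nonneg (pow_nonneg hx 3) hy]) hdet.le,
      div_nonneg (by nlinarith [hg false, hg true, pow_nonneg hx 3]) hdet.le⟩
  | succ N ih =>
    obtain ⟨ihb, iht⟩ := ih
    have hb0 : 0 ≤ ∑ n ∈ Finset.range N, wsumY x y g n false := Finset.sum_nonneg fun n _ => wsumY_nonneg hx hy hg n false
    have ht0 : 0 ≤ ∑ n ∈ Finset.range N, wsumY x y g n true := Finset.sum_nonneg fun n _ => wsumY_nonneg hx hy hg n true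
    constructor
    · rw [Finset.sum_range_succ', wsumY_zero]
      simp only [wsumY_succ, if_true, Bool.true_eq_false, if_false, Finset.sum_add_distrib, ← Finset.mul_sum]
      calc x ^ 2 * ∑ n ∈ Finset.range N, wsumY x y g n false + x ^ 3 * y * ∑ n ∈ Finset.range N, wsumY x y g n true + g false
          ≤ x ^ 2 * Rbot x y g + x ^ 3 * y * Rtop x y g + g false := by
            gcongr
      _ = Rbot x y g := by linarith [Rbot_eq g hdet.ne']
    · rw [Finset.sum_range_succ', wsumY_zero]
      simp only [wsumY_succ, Bool.false_eq_true, if_false, if_true, Finset.sum_add_distrib, ← Finset.mul_sum]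
      calc x ^ 3 * ∑ n ∈ Finset.range N, wsumY x y g n false + x ^ 2 * y * ∑ n ∈ Finset.range N, wsumY x y g n true + g true
          ≤ x ^ 3 * Rbot x y g + x ^ 2 * y * Rtop x y g + g true := by
            gcongr
      _ = Rtop x y g := by linarith [Rtop_eq g hdet.ne']

/-- **Perron eigenvector bound at the critical `y`**: with `y = (1 − x²)/(x²(1 − x² + x⁴))` (so `det(I − M(y)) = 0`) and
`u = (x³y, 1 − x²)`, `M(y) u = u` and `W_{n+1} ≥ u` componentwise for the end weight `1_⊤` — the weave series from `⊥` to `⊤`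
grows at least linearly. [cite: BeatonBousquetMelouDeGierDuminilCopinGuttmann2014, Corollary 8 (arXiv v5 p. 12: y_T as the radius of B_T(x_c;y)); lane: width-two transfer bound] -/
theorem wsumY_succ_ge {x : ℝ} (hx0 : 0 < x) (hx1 : x < 1) (n : ℕ) :
    x ^ 3 * ((1 - x ^ 2) / (x ^ 2 * (1 - x ^ 2 + x ^ 4))) ≤
        wsumY x ((1 - x ^ 2) / (x ^ 2 * (1 - x ^ 2 + x ^ 4))) (fun c => if c then 1 else 0) (n + 1) false ∧
      1 - x ^ 2 ≤ wsumY x ((1 - x ^ 2) / (x ^ 2 * (1 - x ^ 2 + x ^ 4))) (fun c => if c then 1 else 0) (n + 1) true := by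
  set y := (1 - x ^ 2) / (x ^ 2 * (1 - x ^ 2 + x ^ 4)) with hy
  have hq : 0 < 1 - x ^ 2 + x ^ 4 := by nlinarith [sq_nonneg (x ^ 2)]
  have hx2 : 0 < x ^ 2 := by positivity
  have hx21 : x ^ 2 < 1 := by nlinarith
  have hden : 0 < x ^ 2 * (1 - x ^ 2 + x ^ 4) := mul_pos hx2 hq
  have hy0 : 0 ≤ y := div_nonneg (by linarith) hden.le
  -- the eigen-relation `y · x²(1 − x² + x⁴) = 1 − x²` and the base inequality `x²y ≥ 1 − x²`
  have hkey : y * (x ^ 2 * (1 - x ^ 2 + x ^ 4)) = 1 - x ^ 2 := div_mul_cancel₀ _ hden.ne'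
  have hbase : 1 - x ^ 2 ≤ x ^ 2 * y := by
    rw [hy, mul_div_assoc', le_div_iff₀ hden]
    have hx4 : x ^ 4 ≤ x ^ 2 := by nlinarith
    nlinarith
  induction n with
  | zero =>
    simp only [zero_add, wsumY_succ, wsumY_zero, if_true, Bool.true_eq_false, if_false, Bool.false_eq_true, mul_zero,
      zero_add, mul_one]
    exact ⟨le_rfl, hbase⟩
  | succ n ih =>
    obtain ⟨ihb, iht⟩ := ih
    rw [wsumY_succ x y _ (n + 1) false, wsumY_succ x y _ (n + 1) true]
    simp only [if_true, Bool.true_eq_false, if_false]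
    have hx3y : 0 ≤ x ^ 3 * y := mul_nonneg (pow_nonneg hx0.le 3) hy0
    have hx2y : 0 ≤ x ^ 2 * y := mul_nonneg (pow_nonneg hx0.le 2) hy0
    constructor
    · calc x ^ 3 * y = x ^ 2 * (x ^ 3 * y) + x ^ 3 * y * (1 - x ^ 2) := by ring
        _ ≤ x ^ 2 * wsumY x y (fun c => if c then 1 else 0) (n + 1) false +
            x ^ 3 * y * wsumY x y (fun c => if c then 1 else 0) (n + 1) true :=
          add_le_add (mul_le_mul_of_nonneg_left ihb (pow_nonneg hx0.le 2)) (mul_le_mul_of_nonneg_left iht hx3y)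
    · calc 1 - x ^ 2 = x ^ 3 * (x ^ 3 * y) + x ^ 2 * y * (1 - x ^ 2) := by nlinarith [hkey]
        _ ≤ x ^ 3 * wsumY x y (fun c => if c then 1 else 0) (n + 1) false +
            x ^ 2 * y * wsumY x y (fun c => if c then 1 else 0) (n + 1) true :=
          add_le_add (mul_le_mul_of_nonneg_left ihb (pow_nonneg hx0.le 3)) (mul_le_mul_of_nonneg_left iht hx2y)

/-! ### §3. The `y`-weighted `β`-family sum and its closed decomposition -/

/-- The `y`-weighted excursion sum `Σ_{k<N} x^{4k+3} y^{k+1}` (a returning excursion of depth `2k+1` with its `k+1` contacts).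
[cite: DuminilCopinSmirnov2012, §3 (Fig. 3); lane: width-two bookkeeping] -/
def rsumY (x y : ℝ) (N : ℕ) : ℝ := ∑ k ∈ Finset.range N, x ^ (4 * k + 3) * y ^ (k + 1)

/-- `rsumY ≥ 0`. [cite: BeatonBousquetMelouDeGierDuminilCopinGuttmann2014, §2, eq. (10) (arXiv v5 p. 6: B_{T,L}(x;y)); lane: width-two transfer bookkeeping] -/
theorem rsumY_nonneg {x y : ℝ} (hx : 0 ≤ x) (hy : 0 ≤ y) (N : ℕ) : 0 ≤ rsumY x y N :=
  Finset.sum_nonneg fun _ _ => mul_nonneg (pow_nonneg hx _) (pow_nonneg hy _)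

/-- `rsumY ≤ x³y/(1 − x⁴y)` when `0 ≤ x⁴y < 1` (geometric series). [cite: BeatonBousquetMelouDeGierDuminilCopinGuttmann2014, §2, eq. (10) (arXiv v5 p. 6: B_{T,L}(x;y)); lane: width-two transfer bookkeeping] -/
theorem rsumY_le {x y : ℝ} (hx : 0 ≤ x) (hy : 0 ≤ y) (h : x ^ 4 * y < 1) (N : ℕ) :
    rsumY x y N ≤ x ^ 3 * y / (1 - x ^ 4 * y) := by
  have hr0 : 0 ≤ x ^ 4 * y := mul_nonneg (pow_nonneg hx 4) hy
  have h1 : rsumY x y N = x ^ 3 * y * ∑ k ∈ Finset.range N, (x ^ 4 * y) ^ k := by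
    rw [rsumY, Finset.mul_sum]
    refine Finset.sum_congr rfl fun k _ => ?_
    rw [mul_pow, ← pow_mul, pow_succ, pow_add]
    ring
  have hgeo : ∑ k ∈ Finset.range N, (x ^ 4 * y) ^ k ≤ 1 / (1 - x ^ 4 * y) := by
    rw [le_div_iff₀ (by linarith), geom_sum_mul_neg]
    linarith [pow_nonneg hr0 N]
  rw [h1]
  calc x ^ 3 * y * ∑ k ∈ Finset.range N, (x ^ 4 * y) ^ k ≤ x ^ 3 * y * (1 / (1 - x ^ 4 * y)) :=
      mul_le_mul_of_nonneg_left hgeo (mul_nonneg (pow_nonneg hx 3) hy)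
    _ = x ^ 3 * y / (1 - x ^ 4 * y) := by ring

/-- **The `y`-weighted `β`-family sum** `Σ_{q ∈ paramsB N} x^{|fw q|} y^{c(fw q)}`. [cite: BeatonBousquetMelouDeGierDuminilCopinGuttmann2014, §2, eq. (10) (arXiv v5 p. 6: B_{T,L}(x;y)); lane: width two] -/
def fsumY (x y : ℝ) (N : ℕ) : ℝ := ∑ q ∈ paramsB N, x ^ qlen q * y ^ qcon q

/-- `Σ_{s = ±1} c = 2c`. [folklore] -/
private theorem sum_signs' (c : ℝ) : ∑ _s ∈ signs, c = 2 * c := by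
  rw [signs, Finset.sum_pair (by norm_num)]; ring

/-- Summing the `β` weights over the right excursions (with contacts). [cite: DuminilCopinSmirnov2012, §3 (Fig. 3); lane: width two] -/
theorem sum_right_betaY (x y : ℝ) (N : ℕ) (left : Option ℕ) (l : List Bool) :
    ∑ right ∈ optN N, (if frail left l right = true then
        x ^ elen left l right * y ^ qcon ((1 : ℤ), left, l, right) else 0) =
      x ^ (1 + left.elim 0 (fun k => 4 * k + 3) + wlen left.isSome l) *
        y ^ (left.elim 0 (fun k => k + 1) + l.count true) * (if wend left.isSome l then 1 else rsumY x y N) := by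
  rw [optN, Finset.sum_insertNone]
  cases h : wend left.isSome l
  · simp only [frail, Option.isSome_none, Bool.false_eq_true, if_false, h, Option.isSome_some, if_true, Bool.not_false,
      elen, Option.elim_some, qcon, Option.elim_none, add_zero, Bool.false_eq_true, zero_add, rsumY, Finset.mul_sum]
    refine Finset.sum_congr rfl fun k _ => ?_
    rw [pow_add, pow_add]
    ring
  · simp [frail, elen, h, qcon]

/-- Summing over the weave words by length (with contacts). [cite: DuminilCopinSmirnov2012, §3 (Fig. 3); lane: width two] -/
theorem sum_wordsY (x y : ℝ) (N : ℕ) (E C : ℕ) (r : Bool) (G : Bool → ℝ) :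
    ∑ l ∈ wordsN N, x ^ (1 + E + wlen r l) * y ^ (C + l.count true) * G (wend r l) =
      x ^ (1 + E) * y ^ C * ∑ n ∈ Finset.range N, wsumY x y G (n + 1) r := by
  rw [Finset.mul_sum, wordsN, Finset.sum_biUnion]
  · refine Finset.sum_congr rfl fun n _ => ?_
    rw [wsumY, Finset.mul_sum]
    exact Finset.sum_congr rfl fun l _ => by rw [pow_add, pow_add]; ring
  · intro n _ m _ hnm
    rw [Function.onFun, Finset.disjoint_left]
    intro l h1 h2
    exact hnm (by have := length_of_mem_bwords' h1; have := length_of_mem_bwords' h2; omega)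

/-- Summing over the left excursions (with contacts). [cite: DuminilCopinSmirnov2012, §3 (Fig. 3); lane: width two] -/
theorem sum_leftY (x y : ℝ) (N : ℕ) (Ψ : Bool → ℝ) :
    ∑ left ∈ optN N, x ^ (1 + left.elim 0 (fun k => 4 * k + 3)) * y ^ (left.elim 0 fun k => k + 1) * Ψ left.isSome =
      x * (Ψ false + rsumY x y N * Ψ true) := by
  rw [optN, Finset.sum_insertNone]
  simp only [Option.elim_none, Option.isSome_none, Option.elim_some, Option.isSome_some, add_zero, pow_one, pow_zero, mul_one]
  have : ∑ k ∈ Finset.range N, x ^ (1 + (4 * k + 3)) * y ^ (k + 1) * Ψ true = x * (rsumY x y N * Ψ true) := by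
    rw [rsumY, Finset.sum_mul, Finset.mul_sum]
    exact Finset.sum_congr rfl fun k _ => by rw [pow_add, pow_one]; ring
  rw [this]; ring

/-- **The `y`-weighted `β`-family sum in closed form** (weave series with end weights `G(⊤) = 1`, `G(⊥) = rsumY`):
`fsumY = 2x[ΣW(⊥) + rsumY·ΣW(⊤)] + 2x·rsumY`. [cite: BeatonBousquetMelouDeGierDuminilCopinGuttmann2014, §2, eq. (10) (arXiv v5 p. 6); lane: width two] -/
theorem fsumY_eq (x y : ℝ) (N : ℕ) :
    fsumY x y N =
      2 * (x * ((∑ n ∈ Finset.range N, wsumY x y (fun c => if c then 1 else rsumY x y N) (n + 1) false) +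
        rsumY x y N * ∑ n ∈ Finset.range N, wsumY x y (fun c => if c then 1 else rsumY x y N) (n + 1) true)) +
      2 * (x * rsumY x y N) := by
  have hdisj : Disjoint ((paramsW N).filter (fun q => qrail q = true)) (paramsZ N) := by
    rw [Finset.disjoint_left]
    rintro ⟨s, left, l, right⟩ h1 h2
    simp only [Finset.mem_filter, paramsW, paramsZ, Finset.mem_product, Finset.mem_singleton] at h1 h2
    obtain ⟨⟨-, -, hl, -⟩, -⟩ := h1
    obtain ⟨-, -, rfl, -⟩ := h2
    simp only [wordsN, Finset.mem_biUnion] at hl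
    obtain ⟨n, -, hn⟩ := hl
    have := length_of_mem_bwords' hn
    simp at this
  rw [fsumY, paramsB, Finset.sum_union hdisj]
  congr 1
  · rw [Finset.sum_filter, paramsW, Finset.sum_product]
    simp only [Finset.sum_product, qrail, qlen]
    have hs : ∀ s ∈ signs, ∀ (left : Option ℕ) (l : List Bool) (right : Option ℕ),
        (if frail left l right = true then x ^ elen left l right * y ^ qcon (s, left, l, right) else 0) =
        (if frail left l right = true then x ^ elen left l right * y ^ qcon ((1 : ℤ), left, l, right) else 0) :=
      fun _ _ _ _ _ => rfl
    rw [Finset.sum_congr rfl fun s hs' => Finset.sum_congr rfl fun left _ => Finset.sum_congr rfl fun l _ =>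
      Finset.sum_congr rfl fun right _ => hs s hs' left l right]
    rw [sum_signs']
    congr 1
    set G : Bool → ℝ := fun c => if c then 1 else rsumY x y N with hG
    have step : ∀ left : Option ℕ, ∑ l ∈ wordsN N, ∑ right ∈ optN N,
        (if frail left l right = true then x ^ elen left l right * y ^ qcon ((1 : ℤ), left, l, right) else 0) =
        x ^ (1 + left.elim 0 (fun k => 4 * k + 3)) * y ^ (left.elim 0 fun k => k + 1) *
          ∑ n ∈ Finset.range N, wsumY x y G (n + 1) left.isSome := by
      intro left
      simp only [sum_right_betaY]
      exact sum_wordsY x y N _ _ left.isSome G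
    simp only [step]
    rw [sum_leftY x y N (fun r => ∑ n ∈ Finset.range N, wsumY x y G (n + 1) r)]
  · rw [paramsZ, Finset.sum_product]
    simp only [Finset.sum_product, Finset.sum_singleton, qlen, qcon]
    rw [signs, Finset.sum_pair (by norm_num), ← two_mul, Finset.sum_image (fun a _ b _ h => Option.some_injective _ h)]
    congr 1
    rw [rsumY, Finset.mul_sum]
    refine Finset.sum_congr rfl fun k _ => ?_
    simp only [elen, Option.elim_none, Option.isSome_none, wlen, add_zero, Option.elim_some, List.count_nil, wend,
      Bool.false_eq_true, if_false, zero_add]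
    rw [pow_add, pow_one]
    ring

/-! ### §4. The family sum against `B_{2,L}(x_c; y)`: completeness and injectivity -/

/-- Parameters in `paramsB N` have side `s = ±1`. [cite: DuminilCopinSmirnov2012, §3 (Fig. 3: the symmetry of S_{T,L})] -/
theorem fst_eq_of_mem_paramsB {N : ℕ} {q : Param} (hq : q ∈ paramsB N) : q.1 = 1 ∨ q.1 = -1 := by
  obtain ⟨s, left, l, right⟩ := q
  simp only [paramsB, paramsW, paramsZ, signs, Finset.mem_union, Finset.mem_filter, Finset.mem_product,
    Finset.mem_insert, Finset.mem_singleton] at hq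
  rcases hq with ⟨⟨hs, -⟩, -⟩ | ⟨hs, -⟩ <;> exact hs

/-- **`fsumY ≤ B_{2,2N}(x_c; y)`** (`y ≥ 0`): the family walks are distinct `β`-walks of `S_{2,2N}` with the computed contacts.
[cite: BeatonBousquetMelouDeGierDuminilCopinGuttmann2014, §2, eq. (10) (arXiv v5 p. 6: B_{T,L}(x;y)); lane: width two] -/
theorem fsumY_le_stripGFy {y : ℝ} (hy : 0 ≤ y) (N : ℕ) :
    fsumY hexCriticalFugacity y N ≤ stripGFy 2 (2 * N) (IsBetaDart 2) y := by
  have hx : 0 ≤ hexCriticalFugacity := hexCriticalFugacity_pos_lt_one.1.le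
  have h1 : fsumY hexCriticalFugacity y N =
      ∑ P ∈ (paramsB N).image fw, hexCriticalFugacity ^ mwLen P * y ^ surfContacts 2 P := by
    rw [fsumY, Finset.sum_image (fw_injOn_paramsB N)]
    refine Finset.sum_congr rfl fun q hq => ?_
    rw [surfContacts_fw (fst_eq_of_mem_paramsB hq), fw, mwLen_famWalk, qlen]
  rw [h1, stripGFy]
  exact Finset.sum_le_sum_of_subset_of_nonneg (Finset.image_subset_iff.2 fun q hq => fw_mem_beta hq)
    fun P _ _ => mul_nonneg (pow_nonneg hx _) (pow_nonneg hy _)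

/-- **`B_{2,L}(x_c; y) ≤ fsumY (L+2)`** (`y ≥ 0`): COMPLETENESS of the families (`W2.exists_param_of_mem`).
[cite: BeatonBousquetMelouDeGierDuminilCopinGuttmann2014, §2, eq. (10) (arXiv v5 p. 6); lane: width two] -/
theorem stripGFy_le_fsumY {y : ℝ} (hy : 0 ≤ y) (L : ℕ) :
    stripGFy 2 L (IsBetaDart 2) y ≤ fsumY hexCriticalFugacity y (L + 2) := by
  have hx : 0 ≤ hexCriticalFugacity := hexCriticalFugacity_pos_lt_one.1.le
  have h1 : fsumY hexCriticalFugacity y (L + 2) =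
      ∑ P ∈ (paramsB (L + 2)).image fw, hexCriticalFugacity ^ mwLen P * y ^ surfContacts 2 P := by
    rw [fsumY, Finset.sum_image (fw_injOn_paramsB (L + 2))]
    refine Finset.sum_congr rfl fun q hq => ?_
    rw [surfContacts_fw (fst_eq_of_mem_paramsB hq), fw, mwLen_famWalk, qlen]
  rw [h1, stripGFy]
  refine Finset.sum_le_sum_of_subset_of_nonneg (fun P hP => ?_) fun P _ _ => mul_nonneg (pow_nonneg hx _) (pow_nonneg hy _)
  rw [Finset.mem_filter] at hP
  obtain ⟨q, hq, hqB, -⟩ := exists_param_of_mem hP.1 (Or.inl hP.2)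
  exact Finset.mem_image.2 ⟨q, hqB hP.2, hq⟩

/-! ### §5. The threshold: `y_2 = (1 − x_c²)/(x_c²(1 − x_c² + x_c⁴)) = (10 + 8√2)/7` -/

/-- **The second threshold** `y_2 := (1 − x_c²)/(x_c²(1 − x_c² + x_c⁴))`, the zero of `det(I − M(y))` at `x = x_c`.
[cite: BeatonBousquetMelouDeGierDuminilCopinGuttmann2014, Corollary 8 (arXiv v5 p. 12: y_T); lane: the width-two value] -/
def yTwo : ℝ := (1 - hexCriticalFugacity ^ 2) / (hexCriticalFugacity ^ 2 * (1 - hexCriticalFugacity ^ 2 + hexCriticalFugacity ^ 4))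

/-- `0 < x_c²(1 − x_c² + x_c⁴)`. [cite: BeatonBousquetMelouDeGierDuminilCopinGuttmann2014, Corollary 8 (arXiv v5 p. 12: y_T); lane: width-two bookkeeping] -/
theorem yTwo_den_pos : 0 < hexCriticalFugacity ^ 2 * (1 - hexCriticalFugacity ^ 2 + hexCriticalFugacity ^ 4) := by
  have hx := hexCriticalFugacity_pos_lt_one
  exact mul_pos (by nlinarith [hx.1]) (by nlinarith [sq_nonneg (hexCriticalFugacity ^ 2)])

/-- **`y_2 = (10 + 8√2)/7 = 3.0448…`** (from `x_c² = (2 − √2)/2`). [cite: DuminilCopinSmirnov2012, Theorem 1 (x_c = 1/√(2+√2)); lane: the width-two value] -/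
theorem yTwo_eq : yTwo = (10 + 8 * Real.sqrt 2) / 7 := by
  have hs := sqrt_two_eq
  have hm := minpoly_xc
  have hden := yTwo_den_pos
  rw [yTwo, div_eq_div_iff hden.ne' (by norm_num), hs]
  nlinarith [hm]

/-- `det(I − M_{x_c}(y)) = (1 − x_c²) − y·x_c²(1 − x_c² + x_c⁴)`, positive exactly below `y_2`. [cite: BeatonBousquetMelouDeGierDuminilCopinGuttmann2014, Corollary 8 (arXiv v5 p. 12: y_T); lane: width-two bookkeeping] -/
theorem wdet_xc_pos {y : ℝ} (hy : y < yTwo) : 0 < wdet hexCriticalFugacity y := by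
  have hden := yTwo_den_pos
  rw [yTwo, lt_div_iff₀ hden] at hy
  unfold wdet
  nlinarith

/-- `y_2 ≤ x_c⁻²`, so `x_c² y ≤ 1` below `y_2`. [cite: BeatonBousquetMelouDeGierDuminilCopinGuttmann2014, Corollary 8 (arXiv v5 p. 12: y_T); lane: width-two bookkeeping] -/
theorem xc_sq_mul_le_one {y : ℝ} (hy : y ≤ yTwo) : hexCriticalFugacity ^ 2 * y ≤ 1 := by
  have hx := hexCriticalFugacity_pos_lt_one
  have hden := yTwo_den_pos
  have h2 : 0 < hexCriticalFugacity ^ 2 := by nlinarith [hx.1]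
  have hq : 0 < 1 - hexCriticalFugacity ^ 2 + hexCriticalFugacity ^ 4 := by nlinarith [sq_nonneg (hexCriticalFugacity ^ 2)]
  have hyT : yTwo * hexCriticalFugacity ^ 2 ≤ 1 := by
    rw [yTwo, div_mul_eq_mul_div, div_le_iff₀ hden]
    have hx4 : 0 ≤ hexCriticalFugacity ^ 4 := by positivity
    nlinarith
  calc hexCriticalFugacity ^ 2 * y ≤ hexCriticalFugacity ^ 2 * yTwo := mul_le_mul_of_nonneg_left hy h2.le
    _ = yTwo * hexCriticalFugacity ^ 2 := mul_comm _ _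
    _ ≤ 1 := hyT

/-- The explicit bound of `fsumY_le`: `2x_c[(Rg)_⊥ + E·(Rg)_⊤] + 2x_c·E` with `E = x_c³y/(1 − x_c⁴y)` (the excursion series)
and `g = (E, 1)`. [cite: BeatonBousquetMelouDeGierDuminilCopinGuttmann2014, Corollary 8 (arXiv v5 p. 12); lane: width two] -/
def fBound (y : ℝ) : ℝ :=
  2 * (hexCriticalFugacity * (Rbot hexCriticalFugacity y
      (fun c => if c then 1 else hexCriticalFugacity ^ 3 * y / (1 - hexCriticalFugacity ^ 4 * y)) +
    hexCriticalFugacity ^ 3 * y / (1 - hexCriticalFugacity ^ 4 * y) *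
      Rtop hexCriticalFugacity y (fun c => if c then 1 else hexCriticalFugacity ^ 3 * y / (1 - hexCriticalFugacity ^ 4 * y)))) +
  2 * (hexCriticalFugacity * (hexCriticalFugacity ^ 3 * y / (1 - hexCriticalFugacity ^ 4 * y)))

/-- **Below `y_2` the family sums are uniformly bounded** (`0 ≤ y < y_2`, `x = x_c`): the explicit Collatz–Wielandt bound.
[cite: BeatonBousquetMelouDeGierDuminilCopinGuttmann2014, Corollary 8 (arXiv v5 p. 12: y_T as the radius of B_T(x_c;y)); lane: width two] -/
theorem fsumY_le {y : ℝ} (hy : 0 ≤ y) (hlt : y < yTwo) (N : ℕ) : fsumY hexCriticalFugacity y N ≤ fBound y := by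
  set x := hexCriticalFugacity with hxdef
  have hx := hexCriticalFugacity_pos_lt_one
  have hx0 : 0 ≤ x := hx.1.le
  have h1 : x ^ 2 * y ≤ 1 := xc_sq_mul_le_one hlt.le
  have h2 : x ^ 2 ≤ 1 := by nlinarith [hx.1, hx.2]
  have h4 : x ^ 4 * y < 1 := by
    have : x ^ 4 * y = x ^ 2 * (x ^ 2 * y) := by ring
    rw [this]
    calc x ^ 2 * (x ^ 2 * y) ≤ x ^ 2 * 1 := mul_le_mul_of_nonneg_left h1 (pow_nonneg hx0 2)
      _ < 1 := by nlinarith [hx.1, hx.2]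
  have hdet := wdet_xc_pos hlt
  set E := x ^ 3 * y / (1 - x ^ 4 * y) with hE
  have hE0 : 0 ≤ E := div_nonneg (mul_nonneg (pow_nonneg hx0 3) hy) (by linarith)
  have hrs : rsumY x y N ≤ E := rsumY_le hx0 hy h4 N
  have hrs0 : 0 ≤ rsumY x y N := rsumY_nonneg hx0 hy N
  set G : Bool → ℝ := fun c => if c then 1 else rsumY x y N with hG
  set G' : Bool → ℝ := fun c => if c then 1 else E with hG'
  have hG0 : ∀ r, 0 ≤ G r := fun r => by cases r <;> simp [hG, hrs0]
  have hG'0 : ∀ r, 0 ≤ G' r := fun r => by cases r <;> simp [hG', hE0]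
  have hGG' : ∀ r, G r ≤ G' r := fun r => by cases r <;> simp [hG, hG', hrs]
  -- the weave partial sums with end weight G ≤ those with G' ≤ resolvent
  have hW : ∀ r, ∑ n ∈ Finset.range N, wsumY x y G (n + 1) r ≤ ∑ n ∈ Finset.range (N + 1), wsumY x y G' n r := by
    intro r
    rw [Finset.sum_range_succ']
    calc ∑ n ∈ Finset.range N, wsumY x y G (n + 1) r
        ≤ ∑ n ∈ Finset.range N, wsumY x y G' (n + 1) r := Finset.sum_le_sum fun n _ => wsumY_mono hx0 hy hGG' _ _
      _ ≤ ∑ n ∈ Finset.range N, wsumY x y G' (n + 1) r + wsumY x y G' 0 r :=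
          le_add_of_nonneg_right (wsumY_nonneg hx0 hy hG'0 0 r)
  obtain ⟨hRb, hRt⟩ := sum_wsumY_le hx0 hy hG'0 hdet h1 h2 (N + 1)
  have hb := (hW false).trans hRb
  have ht := (hW true).trans hRt
  have hSWt0 : 0 ≤ ∑ n ∈ Finset.range N, wsumY x y G (n + 1) true :=
    Finset.sum_nonneg fun n _ => wsumY_nonneg hx0 hy hG0 _ _
  have hprod : rsumY x y N * ∑ n ∈ Finset.range N, wsumY x y G (n + 1) true ≤ E * Rtop x y G' :=
    mul_le_mul hrs ht hSWt0 hE0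
  have hsum1 := mul_le_mul_of_nonneg_left (add_le_add hb hprod) hx0
  have hsum2 := mul_le_mul_of_nonneg_left hrs hx0
  rw [fsumY_eq, fBound]
  linarith

/-- **At `y_2` the family sums are unbounded**: `fsumY x_c y_2 N ≥ 2 x_c⁴ y_2 · N`.
[cite: BeatonBousquetMelouDeGierDuminilCopinGuttmann2014, Corollary 8 (arXiv v5 p. 12: y_T as the radius of B_T(x_c;y)); lane: width two] -/
theorem fsumY_yTwo_ge (N : ℕ) : 2 * (hexCriticalFugacity ^ 4 * yTwo) * N ≤ fsumY hexCriticalFugacity yTwo N := by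
  set x := hexCriticalFugacity with hxdef
  have hx := hexCriticalFugacity_pos_lt_one
  have hx0 : 0 ≤ x := hx.1.le
  have hy0 : 0 ≤ yTwo := div_nonneg (by nlinarith [hx.1, hx.2]) yTwo_den_pos.le
  have hrs0 : 0 ≤ rsumY x yTwo N := rsumY_nonneg hx0 hy0 N
  set G : Bool → ℝ := fun c => if c then 1 else rsumY x yTwo N with hG
  have hG0 : ∀ r, 0 ≤ G r := fun r => by cases r <;> simp [hG, hrs0]
  have hGge : ∀ r, (fun c : Bool => if c then (1 : ℝ) else 0) r ≤ G r := fun r => by cases r <;> simp [hG, hrs0]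
  -- each weave term from ⊥ is at least `x³ y₂`
  have hterm : ∀ n, x ^ 3 * yTwo ≤ wsumY x yTwo G (n + 1) false := fun n =>
    ((wsumY_succ_ge hx.1 hx.2 n).1).trans (wsumY_mono hx0 hy0 hGge _ _)
  have hsum : (N : ℝ) * (x ^ 3 * yTwo) ≤ ∑ n ∈ Finset.range N, wsumY x yTwo G (n + 1) false := by
    calc (N : ℝ) * (x ^ 3 * yTwo) = ∑ _n ∈ Finset.range N, x ^ 3 * yTwo := by rw [Finset.sum_const, Finset.card_range]; ring
      _ ≤ _ := Finset.sum_le_sum fun n _ => hterm n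
  have hT0 : 0 ≤ ∑ n ∈ Finset.range N, wsumY x yTwo G (n + 1) true := Finset.sum_nonneg fun n _ => wsumY_nonneg hx0 hy0 hG0 _ _
  have h1 := mul_le_mul_of_nonneg_left hsum hx0
  have h2 : 0 ≤ x * (rsumY x yTwo N * ∑ n ∈ Finset.range N, wsumY x yTwo G (n + 1) true) :=
    mul_nonneg hx0 (mul_nonneg hrs0 hT0)
  have h3 : 0 ≤ x * rsumY x yTwo N := mul_nonneg hx0 hrs0
  have h4 : x * ((N : ℝ) * (x ^ 3 * yTwo)) = (hexCriticalFugacity ^ 4 * yTwo) * N := by rw [hxdef]; ring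
  rw [fsumY_eq]
  linarith

/-! ### §6. The threshold theorems -/

/-- Below `y_2` the critical weighted bridge class of `S_2` is bounded: `[0, y_2) ⊆ stripBddSet 2`.
[cite: BeatonBousquetMelouDeGierDuminilCopinGuttmann2014, Corollary 8 (arXiv v5 p. 12); lane: width two] -/
theorem mem_stripBddSet_two_of_lt {y : ℝ} (hy : 0 ≤ y) (hlt : y < yTwo) : y ∈ stripBddSet 2 := by
  refine ⟨hy, ⟨fBound y, ?_⟩⟩
  rintro _ ⟨L, rfl⟩
  exact (stripGFy_le_fsumY hy L).trans (fsumY_le hy hlt (L + 2))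

/-- At `y_2` the class is unbounded. [cite: BeatonBousquetMelouDeGierDuminilCopinGuttmann2014, Corollary 8 (arXiv v5 p. 12); lane: width two] -/
theorem not_bddAbove_stripGFy_two_yTwo : ¬ BddAbove (Set.range fun L : ℕ => stripGFy 2 L (IsBetaDart 2) yTwo) := by
  rintro ⟨K, hK⟩
  have hx := hexCriticalFugacity_pos_lt_one
  have hy0 : 0 ≤ yTwo := div_nonneg (by nlinarith [hx.1, hx.2]) yTwo_den_pos.le
  have hy1 : 0 < yTwo := div_pos (by nlinarith [hx.1, hx.2]) yTwo_den_pos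
  have hc : 0 < 2 * (hexCriticalFugacity ^ 4 * yTwo) := mul_pos (by norm_num) (mul_pos (pow_pos hx.1 4) hy1)
  obtain ⟨N, hN⟩ := exists_nat_gt (K / (2 * (hexCriticalFugacity ^ 4 * yTwo)))
  have h1 := fsumY_yTwo_ge N
  have h2 := (fsumY_le_stripGFy hy0 N).trans (hK ⟨2 * N, rfl⟩)
  rw [div_lt_iff₀ hc] at hN
  nlinarith

end W2

open W2 in
/-- **`y_2 = (10 + 8√2)/7`**: the second Duminil-Copin–Smirnov strip threshold is exact.
[cite: BeatonBousquetMelouDeGierDuminilCopinGuttmann2014, Corollary 8 (arXiv v5 p. 12: "y_T … decreases to the critical fugacity y_c"); lane corollary: the second term of that sequence, not stated in print] -/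
theorem stripYT_two : stripYT 2 = (10 + 8 * Real.sqrt 2) / 7 := by
  rw [← yTwo_eq]
  have hx := hexCriticalFugacity_pos_lt_one
  have hy1 : 0 < yTwo := div_pos (by nlinarith [hx.1, hx.2]) yTwo_den_pos
  refine le_antisymm ?_ ?_
  · exact stripYT_le ⟨yTwo / 2, mem_stripBddSet_two_of_lt (half_pos hy1).le (half_lt_self hy1)⟩ hy1.le
      not_bddAbove_stripGFy_two_yTwo
  · refine le_of_forall_lt fun c hc => ?_
    have h1 : max c 0 < (max c 0 + yTwo) / 2 := by have := max_lt hc hy1; linarith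
    have h2 : (max c 0 + yTwo) / 2 < yTwo := by have := max_lt hc hy1; linarith
    have h0 : 0 ≤ (max c 0 + yTwo) / 2 := le_trans (le_max_right c 0) h1.le
    exact lt_of_lt_of_le (lt_of_le_of_lt (le_max_left c 0) h1)
      (le_stripYT (by norm_num) h0 (mem_stripBddSet_two_of_lt h0 h2).2)

/-- **`y* < y_2`**: an instance of the printed "y_T > y_c for all T" (Cor. 8, proof p. 13).
[cite: BeatonBousquetMelouDeGierDuminilCopinGuttmann2014, Corollary 8 (arXiv v5 p. 12; proof p. 13: "y_T > y_c for all T"); lane: the instance T = 2 with the exact value] -/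
theorem yStar_lt_stripYT_two : yStar < stripYT 2 := by
  rw [stripYT_two, yStar]
  have := Real.sqrt_nonneg 2
  linarith

/-- **`y_2 < y_1`**: the first STRICT instance of the printed "y_{T+1} < y_T" (Cor. 8, proof p. 13) in the tree:
`(10 + 8√2)/7 < 2 + √2`. [cite: BeatonBousquetMelouDeGierDuminilCopinGuttmann2014, Corollary 8 (arXiv v5 p. 12; proof p. 13: "y_{T+1} < y_T"); lane: the instance T = 1 with both exact values] -/
theorem stripYT_two_lt_stripYT_one : stripYT 2 < stripYT 1 := by
  rw [stripYT_two, stripYT_one]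
  have h2 : Real.sqrt 2 < 2 := by
    rw [W2.sqrt_two_eq]
    nlinarith [hexCriticalFugacity_pos_lt_one.1]
  linarith

end Literature.Probability.RandomPlanarGeometry.SAW.HV
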